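import Summits.BirchSwinnertonDyer.BirchSwinnertonDyer.Theorems.TwoAdicConverseLambdaHalfDefs
import Summits.BirchSwinnertonDyer.Rank1Residual.F1Sign2.AnalyticLineTransferAtTwo
import HarnessLib

/-!
# Sketch supplement (crux-ideate r1, ideator 1, GEN 4) — idea `elliptic-shadow-two`, crux `OrdLambdaHalfAtTwo`
# (item stmt-BirchSwinnertonDyer-19556, route TwoAdicConverse, rung S3)

One small PROVED lemma answering the pen's off-habitat question for the stratum (γ₂) = {image `S₃`,
`−Δ_E ∈ (ℚˣ)²`} of `R0OffBigImageGoodOrd`: (γ₂) lies INSIDE the rigid locus `𝔖⁻` of the card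
(`EllipticShadowTwo.OnRigidLocusAtTwo` of `Cruxes/OrdLambdaHalfAtTwo/EllipticShadowTwoSketch.lean`: `Δ < 0`,
`Δ ∉ (ℚ₂ˣ)²`, no rational `2`-torsion; the conclusion below is that definition UNFOLDED, so that this file does not
import the (unbuilt) sketch module — `onRigidLocusAtTwo_of_isSquare_neg_Δ W hsq hirr : OnRigidLocusAtTwo W` holds by
`Iff.rfl` once both files are imported), because `−1` is not a square in `ℚ₂`.
So every curve of (γ₂) is in the habitat of `lambdaHalfAtTwo_of_shadow` (F = ℚ(i), `2` ramified in F).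
Nothing about BSD is asserted or proved here.
-/

set_option linter.dupNamespace false
set_option autoImplicit false

noncomputable section

open WeierstrassCurve Literature.NumberTheory.EllipticCurves.Greenberg1999

namespace Summit.BirchSwinnertonDyer.BirchSwinnertonDyer.Cruxes.OrdLambdaHalfAtTwo.EllipticShadowTwo

/-- `−1` is not a square in `ℚ₂` (a square root would be a `2`-adic unit whose square is `−1 (mod 4)`). -/
theorem not_isSquare_neg_one_padicTwo : ¬ IsSquare (-1 : ℚ_[2]) := by
  rintro ⟨t, ht⟩
  have hn : ‖t‖ = 1 := by
    have h := congrArg (‖·‖) ht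
    simp only [norm_neg, norm_one, norm_mul] at h
    nlinarith [norm_nonneg t]
  let u : ℤ_[2] := ⟨t, hn.le⟩
  have hu : u * u = -1 := by
    apply Subtype.ext
    push_cast
    exact ht.symm
  have h4 := congrArg (PadicInt.toZModPow 2) hu
  rw [map_mul, map_neg, map_one] at h4
  revert h4
  generalize PadicInt.toZModPow 2 u = a
  change ∀ _ : (a : ZMod 4) * a = -1, False
  revert a
  decide

/-- **(γ₂) ⊂ 𝔖⁻.** An elliptic curve over `ℚ` with `−Δ` a rational square and no rational `2`-torsion
`x`-coordinate lies on the rigid locus at `2`: `Δ < 0` and `Δ` is not a square in `ℚ₂` (else `−1 = Δ·(−Δ)⁻¹`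
would be a `2`-adic square).  Hence the pen's off-habitat stratum (γ₂) = {`S₃` image, `−Δ ∈ (ℚˣ)²`} is
covered by the habitat of `lambdaHalfAtTwo_of_shadow` (resolvent field `F = ℚ(√Δ) = ℚ(i)`, `2` ramified). -/
theorem onRigidLocusAtTwo_of_isSquare_neg_Δ (W : WeierstrassCurve ℚ) [W.IsElliptic]
    (hsq : IsSquare (-W.Δ)) (hirr : ∀ x : ℚ, ¬ HasRationalTwoTorsionX W x) :
    W.Δ < 0 ∧ ¬ IsSquare ((W.Δ : ℚ) : ℚ_[2]) ∧ ∀ x : ℚ, ¬ HasRationalTwoTorsionX W x := by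
  have hΔ : W.Δ ≠ 0 := W.isUnit_Δ.ne_zero
  obtain ⟨r, hr⟩ := hsq
  have hr0 : r ≠ 0 := by
    rintro rfl
    exact hΔ (by simpa using hr)
  refine ⟨?_, ?_, hirr⟩
  · rcases lt_or_gt_of_ne hΔ with h | h
    · exact h
    · exfalso; nlinarith [mul_self_nonneg r]
  · rintro ⟨s, hs⟩
    apply not_isSquare_neg_one_padicTwo
    refine ⟨s / r, ?_⟩
    have hr' : ((r : ℚ) : ℚ_[2]) * (r : ℚ_[2]) = -((W.Δ : ℚ) : ℚ_[2]) := by exact_mod_cast hr.symm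
    have hr0' : ((r : ℚ) : ℚ_[2]) ≠ 0 := by exact_mod_cast hr0
    field_simp
    linear_combination hs - hr'

end Summit.BirchSwinnertonDyer.BirchSwinnertonDyer.Cruxes.OrdLambdaHalfAtTwo.EllipticShadowTwo

end
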